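import Summits.QuantumFields.YangMills.Theorems.UnitScaleTiltProp7StubEXOfChartPiecesTwSR
import Summits.QuantumFields.YangMills.Theorems.UnitScaleTiltProp7StubEXOfDisplayedRowsWWSE
import Summits.QuantumFields.YangMills.Theorems.UnitScaleTiltProp7ChartPiecesTwGE
import Summits.QuantumFields.YangMills.Theorems.UnitScaleTiltProp7ChartRealityRowSE
import Summits.QuantumFields.YangMills.Theorems.UnitScaleTiltProp7SolutionRealityRowS
import HarnessLib

/-!
# [v3.2ˢ SOCKET CURRENCY TWIN of ✓`Prop7StubEXOfChartPiecesTwS3`: the Theorem-2 socket reads `Thm2SetupSUAt (F.P K) 2 (K − n) (eta F n K) β₀ B₁ B₂ c₁ len (fun _ => True)` —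
# the weakest currency both consumers need (✓`cov_of_thm2SetupSUAt`, ✓`thm2Based_of_thm2SetupSUAt`); ★★OWNER g27 ACK 55 (1), socket owner's word (T-b) 2026-08-28 12:46Z;
# everything else below VERBATIM.]
# Route `UnitScaleTilt`, crux K1 child «MinimiserStabilityRegPr» (stmt-QuantumFields-19200), skeleton v10, stub `stub_existenceMinimalOrbit` (EX), route (α) — **THE EX KNIT AT THE
# CHART OF RECORD AND THE SYMMETRIC SLICE, v3.0ˢ: THE (γ)-GROWTH ROW RE-KNIT AT THE CRITICAL BACKGROUND AND THE REALITY ROW (R-A₁) FOLDED** (★★OWNER RULINGS №26 ∕ №26a ∕ №30 (3),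
# 2026-08-28; v3.0ˢ pen = the knit lineage seat ym-ust-19200-w2 g4).  As ✓`Prop7StubEXOfChartPiecesTwSR.stubEX_of_chartPiecesTwSR` (v2.9ˢ, the knit of record) with TWO displayed
# rows REPLACED: (1) `hGrowth` — the PINNED-HORN k-uniform relative Poincaré at the curved critical background (located un-suppliable: HGROWTH-PIN ★w4-19200 g4, RULING №25, ★p1 g12's
# numerics 11:14Z `lqP ≈ 2.2ε²` ℓ-independent) — by the reduction (141)–(142) AT THE CRITICAL BACKGROUND `W = (e^{iX}U₀)^u`: an OPAQUE slice letter `Tsl` (print's linear Landau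
# slice `{QA′ = 0, RD*A′ = 0}` at `W` read through (47), sizes included), CHART_W `hChartW` (every admissible competitor `X′` is, in action, a chart point: `A(e^{iX′}U₀) = A(e^{iD}W)`,
# `D ∈ Tsl L i W` Hermitian-traceless — [Balaban1985RegularSpaces] Thm 2 at `W`, (47), gauge invariance of (5)) and LOCMIN_W `hLocW` (`A(W) ≤ A(e^{iD}W)` on the slice — «A′ = 0 is
# a minimum of 𝒜(A′)»; the α-P lane's row: scale-aware TAYLOR ∧ EL_W (✓`Prop7Growth142T3ChartEL`, from the E–L clause) ∧ HESS_W′ ⟹ LOCMIN_W), window `ε₄ ≤ aW L`; (2) `hA₁R`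
# («the solution of (111) is `𝔤`-valued») — by its SUPPLIER ✓`Prop7SolutionRealityRowS.hA₁R_of_letterReality`: the letter-reality rows (R-𝒢) `h𝒢R`, (R-W) `hWR` (N06 ∕ P4 class,
# ym-inputs ∕ ★w4-20520 layer-0 programme + (Q-b) ★w5-20520 g5) and the three `L`-only windows `2B₀α ≤ r`, `4r ≤ a₃`, `16B₀C₄r ≤ 1`.

Cell `ym3-torus`, width seat `ym-ust-19200-w2` (gen 4; EX knit lineage).  THEOREMS ONLY (0 `def`, 0 `sorry`).  CONDITIONAL: this file does NOT close the stub — the remaining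
inputs are displayed hypotheses with named suppliers; `--supports stmt-QuantumFields-19200 --as helper`, count-neutral.  YM₃ on T³ is a ladder rung (R3), not the Clay problem;
nothing here claims the stub, the crux, d = 4 or the mass gap.

THE PRINT.  [Balaban1985Variational] p. 299: *«To see that U_k is a minimum we apply the whole procedure with the configuration U_k instead of U₀ … ⟨δA′, J⟩ = 0 for all
δA′ : QδA′ = 0, RD*δA′ = 0. (141) … 𝒜(A′) = A(U_k) + ½⟨A′, Δ₁A′⟩ + V(A′). (142) A second order differential at A′ = 0 is given by the quadratic form above, and it is
positive definite. Hence A′ = 0 is a minimum»*; Prop. 6 p. 295 and (51) p. 286 (reality of the solution of (111) from the reality of the letters).  EX DISPLAY after this file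
(hypotheses, by name): constants `B₀ C₄ a₃ α r M aW c₀ cB BH ef ε′`; N06 ×2 `norm_G`∕`norm_H₁`; P4 `prop4`; (45)–(46)-twˢ `h46tw` (+ `H` real); (WF) `hWe`∕`hWε`; `hMe`; (W137)
`hw137`; `hBH0`; (W47q)∕(W47R); `h102`∕`h129`; `h102L`∕`h129L`; `hrε`; (R-H₁) `hH₁R`; (R-𝒢) `h𝒢R`; (R-W) `hWR`; `hrα`∕`hr4`∕`hr16`; `hXtw‴` (XL: (112) ∘ (123)–(140) ∘ E–L);
`Tsl` + CHART_W `hChartW` + LOCMIN_W `hLocW`; T2 `hThm2`.  REMOVED relative to v2.9ˢ: `CP θ cS` + `hGrowth`; `hA₁R`.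

WHAT IS PROVED (sorry-free, no definition).  ★★★ **`stubEX_of_chartPiecesTwS3`** — the REGISTERED text of `stub_existenceMinimalOrbit` (all `L > 1`, all `B₃ > 4`) from the
displayed rows: ✓`Prop7StubEXOfDisplayedRowsWW.stubEX_of_displayedRows_wW` at `Lan := IsLandauPrintS (c₀ L) (cB L)`, the chart of record, `β := Λ_k`, `B := Bsym`, with (B20) and
CHART-112ˢ discharged exactly as in v2.9ˢ (✓`bound20_symLog_of_closeAvg`, ✓`chart47twS_of_regPr_eta`, ✓`exists_normS_of_regPr_of_size`, ✓`dbarTwS_window_of_regPr`,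
✓`hChart_of_piecesTwG` ∘ ✓`hXtw_of_split_etaG` ∘ ✓`hXtw'_of_splitG` ∘ ✓`hXtw''_of_reality`, (R-B) ✓`bsym_isHermitian_trace_zero`) and (R-A₁) supplied by
✓`hA₁R_of_letterReality`.

References: T. Bałaban, CMP 102 (1985) 277–309 [Balaban1985Variational]; CMP 99 (1985) 75–102 [Balaban1985RegularSpaces]; CMP 99 (1985) 389–434 [Balaban1985BackgroundPropagators];
CMP 98 (1985) 17–51 [Balaban1985Averaging] (loci in the theorem docstring).
-/

set_option autoImplicit false

noncomputable section

open scoped BigOperators Matrix.Norms.L2Operator Matrix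

namespace Summit.QuantumFields.YangMills.Theorems.Prop7StubEXOfChartPiecesTwS3SE

open NormedSpace
open Literature.MathematicalPhysics.QuantumFieldTheory.Balaban1983to89
open Literature.MathematicalPhysics.QuantumFieldTheory.Balaban1983to89.T3ContinuumYM3Torus
open Literature.MathematicalPhysics.QuantumFieldTheory.Balaban1983to89.T3UnitLawDensityEML (ℰp)
open Literature.MathematicalPhysics.QuantumFieldTheory.Balaban1983to89.T3TiltDescent (descendTo)
open Literature.MathematicalPhysics.QuantumFieldTheory.Balaban1983to89.T3ConstrainedMinimiser (fibre)
open Literature.MathematicalPhysics.QuantumFieldTheory.Balaban1983to89.T3PrintedRegularMinimiser (RegPr regFibrePr)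
open Literature.MathematicalPhysics.QuantumFieldTheory.Balaban1983to89.T3PrintedRegularOrbits (descTransf)
open Literature.MathematicalPhysics.QuantumFieldTheory.Balaban1983to89.T3PrintedMinimiserExistence (regPr_mono)
open Literature.MathematicalPhysics.QuantumFieldTheory.Balaban1983to89.T3Thm1Carrier
open Literature.MathematicalPhysics.QuantumFieldTheory.Balaban1983to89.T3SectALandauChart (In19 emb15 CloseAvg eta)
open BlockAveragingEMLLinearisedBackground (pertVar)
open B9SectCLatticeCarrier (Bond)
open B10Eq27TorusAxialLog (unitsField toUField)
open B11Eq115Space (NegSup NegSize Space115 JetSup)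
open B11Eq111FrakG (nabla115)
open B11Eq98CurrentSlot (Jcur)
open B11Prop3Model (Dfix)
open B13Contraction113 (QuadAnalytic)
open B8Thm2SetupTorus (Thm2SetupSUAt)
open B7Prop2SpecialUnitary (specialUnitaryUnits)
open MatrixLog (mlog)
open Summit.QuantumFields.YangMills.Theorems.Prop7TPrint (nMax19 expHermField)
open Summit.QuantumFields.YangMills.Theorems.Prop7SPrint (AvgCondPrint AvgCondPrintS NormS IsLandauPrint IsLandauPrintS)
open Summit.QuantumFields.YangMills.Theorems.Prop7SectET3Transport (periodsT3 siteEquiv siteEquiv_shiftEquiv bgOfCfg bondEquiv)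
open Summit.QuantumFields.YangMills.Theorems.Prop7SymAvgTwSym (dbarTwS QTwS CmapTwS Chart47T3twS)
open Summit.QuantumFields.YangMills.Theorems.Prop7Bound20SymLog (bound20_symLog_of_closeAvg)
open Summit.QuantumFields.YangMills.Theorems.Prop7ChartPiecesTwGE (hChart_of_piecesTwG hXtw_of_split_etaG hXtw'_of_splitG)
open Summit.QuantumFields.YangMills.Theorems.Prop7StubEXOfDisplayedRowsWWSE (stubEX_of_displayedRows_wWSE)
open Summit.QuantumFields.YangMills.Theorems.Prop7StubEXOfChartPiecesTwSR (bsym_isHermitian_trace_zero)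
open Summit.QuantumFields.YangMills.Theorems.Prop7SolutionRealityRowS (hA₁R_of_letterReality)
open Summit.QuantumFields.YangMills.Theorems.Prop7DbarTwSymWindow (dbarTwS_window_of_regPr)
open Summit.QuantumFields.YangMills.Theorems.Prop7CmapTwSymInputs (chart47twS_of_regPr_eta)
open Summit.QuantumFields.YangMills.Theorems.Prop7StubEXOfChartPiecesTwL (windows_of_admissible three_le_memberL)
open Summit.QuantumFields.YangMills.Theorems.Prop7StubEXOfChartPiecesTwS (windows_of_W)
open Summit.QuantumFields.YangMills.Theorems.Prop7SymSliceWitness (exists_normS_of_regPr_of_size)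
open Summit.QuantumFields.YangMills.Theorems.Prop7DbarTwWindow (norm_smul_I_le_of_nMax19_lt)
open Summit.QuantumFields.YangMills.Theorems.Prop7B8Prop7Div (regPr_emb15_of_in19)
open Summit.QuantumFields.YangMills.Theorems.Prop7PV3CDELogChart (in19_expHermField_of_nMax19_lt)
open Summit.QuantumFields.YangMills.Theorems.Prop7ChartRealityRowSE (hXtw''_of_reality)

variable {L : ℕ}

/-! ## §1 The knit v3.0ˢ in `Thm2SetupSUAt` socket currency -/

set_option maxHeartbeats 400000 in -- HEARTBEAT BUDGET rule (cell README): the knit elaborates at the default 200k but not at 100k (window `linarith`s); line-neutral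
/-- ★★★ **`stub_existenceMinimalOrbit`'s REGISTERED TEXT FROM THE PIECES OF THE CHART OF RECORD, v3.0ˢ — THE GROWTH ROW RE-KNIT AT THE CRITICAL BACKGROUND, (R-A₁) FOLDED**
(★★OWNER RULINGS №26a ∕ №30 (3)): as ✓`stubEX_of_chartPiecesTwSR` (v2.9ˢ) but (1) `hGrowth` (and its constants `CP θ cS`) is REPLACED by the opaque slice `Tsl`, the window constant
`aW` and the two rows CHART_W `hChartW` (every admissible competitor of C-min's ball is, in action, a chart point `e^{iD}W` of the slice at `W = (e^{iX}U₀)^u` — Thm 2 + (47) +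
(5)-invariance) and LOCMIN_W `hLocW` (`A(W) ≤ A(e^{iD}W)` on the slice — (141)–(142)), and (2) `hA₁R` is REPLACED by the letter-reality rows (R-𝒢) `h𝒢R`, (R-W) `hWR` and the windows
`hrα`∕`hr4`∕`hr16`, discharged inside by ✓`Prop7SolutionRealityRowS.hA₁R_of_letterReality`.  Everything else VERBATIM v2.9ˢ.  CONDITIONAL — the stub is not closed.
[cite: Balaban1985Variational, Prop. 7 p.299, (141)-(142) p.299, (51) p.286, (47)–(49) p.285, (103) p.293, (111)–(112) p.294, Props 5–6 pp.294–296, (19)–(21) p.281; Balaban1985RegularSpaces, Thm 2 p.83, (1.37)–(1.38) p.82; Balaban1985BackgroundPropagators, Thm 3.12 p.420, (3.124) p.420] -/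
theorem stubEX_of_chartPiecesTwS3SE
    [hFL : ∀ F : T3Family, Fact (0 < (F.L : ℝ))] [hFη : ∀ (F : T3Family) (k : ℕ), Fact (0 < ((F.L : ℝ)⁻¹) ^ k)]
    -- the constants, member-uniform at each `L` (print: «absolute constants depending on d and L only»)
    (B₀ C₄ a₃ α r M aW : ℕ → ℝ) (hB₀ : ∀ L, 1 < L → 0 < B₀ L) (hC₄ : ∀ L, 1 < L → 0 < C₄ L) (ha₃ : ∀ L, 1 < L → 0 < a₃ L)
    (hα : ∀ L, 1 < L → 0 < α L) (hr : ∀ L, 1 < L → 0 < r L) (hM : ∀ L, 1 < L → 0 < M L) (haW : ∀ L, 1 < L → 0 < aW L)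
    -- the `L²` weights of the projected Landau condition (21)ˢ `IsLandauPrintS` (display place (d); print: `c₀ = η³`, `cB = 1`)
    (c₀ cB : ℕ → ℝ) [hc₀ : ∀ L : ℕ, Fact (0 < c₀ L)]
    -- the curved letters `𝔊(U₀)`, `(δ/δA′)V`, `H₁(U₀)`, OPAQUE (the datum `B` is FIXED to `Bsym` on `Λ_k = PBond (P n) 0`)
    (𝒢f : ∀ (L : ℕ) (i : Idx L) (U₀ : GaugeField (i.1.1.P i.1.2.2) 0 (Matrix.specialUnitaryGroup (Fin 2) ℂ)),
      NegSize (i.1.1.L : ℝ) (((i.1.1.L : ℝ)⁻¹) ^ (i.1.2.2 - i.1.2.1)) (fun _ : Bond 3 (periodsT3 i.1.1 i.1.2.2) => i.1.2.2 - i.1.2.1) 3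
          (Matrix (Fin 2) (Fin 2) ℂ) →L[ℂ]
        Space115 (i.1.1.L : ℝ) (((i.1.1.L : ℝ)⁻¹) ^ (i.1.2.2 - i.1.2.1)) (fun _ : Bond 3 (periodsT3 i.1.1 i.1.2.2) => i.1.2.2 - i.1.2.1)
          (fun _ : Bond 3 (periodsT3 i.1.1 i.1.2.2) × Fin 3 => i.1.2.2 - i.1.2.1) (nabla115 (((i.1.1.L : ℝ)⁻¹) ^ (i.1.2.2 - i.1.2.1)) (bgOfCfg i.1.1 i.1.2.2 U₀)))
    (Wf : ∀ (L : ℕ) (i : Idx L) (U₀ : GaugeField (i.1.1.P i.1.2.2) 0 (Matrix.specialUnitaryGroup (Fin 2) ℂ)),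
      Space115 (i.1.1.L : ℝ) (((i.1.1.L : ℝ)⁻¹) ^ (i.1.2.2 - i.1.2.1)) (fun _ : Bond 3 (periodsT3 i.1.1 i.1.2.2) => i.1.2.2 - i.1.2.1)
          (fun _ : Bond 3 (periodsT3 i.1.1 i.1.2.2) × Fin 3 => i.1.2.2 - i.1.2.1) (nabla115 (((i.1.1.L : ℝ)⁻¹) ^ (i.1.2.2 - i.1.2.1)) (bgOfCfg i.1.1 i.1.2.2 U₀)) →
        NegSize (i.1.1.L : ℝ) (((i.1.1.L : ℝ)⁻¹) ^ (i.1.2.2 - i.1.2.1)) (fun _ : Bond 3 (periodsT3 i.1.1 i.1.2.2) => i.1.2.2 - i.1.2.1) 3 (Matrix (Fin 2) (Fin 2) ℂ))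
    (H₁f : ∀ (L : ℕ) (i : Idx L) (U₀ : GaugeField (i.1.1.P i.1.2.2) 0 (Matrix.specialUnitaryGroup (Fin 2) ℂ)),
      (PBond (i.1.1.P i.1.2.1) 0 → Matrix (Fin 2) (Fin 2) ℂ) →L[ℂ]
        Space115 (i.1.1.L : ℝ) (((i.1.1.L : ℝ)⁻¹) ^ (i.1.2.2 - i.1.2.1)) (fun _ : Bond 3 (periodsT3 i.1.1 i.1.2.2) => i.1.2.2 - i.1.2.1)
          (fun _ : Bond 3 (periodsT3 i.1.1 i.1.2.2) × Fin 3 => i.1.2.2 - i.1.2.1) (nabla115 (((i.1.1.L : ℝ)⁻¹) ^ (i.1.2.2 - i.1.2.1)) (bgOfCfg i.1.1 i.1.2.2 U₀)))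
    -- their displayed bounds (the `SectEDatum` fields at admissible backgrounds)
    (norm_G : ∀ (L : ℕ), 1 < L → ∀ (i : Idx L) (ρ : ℝ) (U₀ : GaugeField (i.1.1.P i.1.2.2) 0 (Matrix.specialUnitaryGroup (Fin 2) ℂ)),
      RegPr i.1.1 i.1.2.1 i.1.2.2 ρ U₀ → ρ ≤ α L → ∀ f, ‖𝒢f L i U₀ f‖ ≤ B₀ L * ‖f‖)
    (prop4 : ∀ (L : ℕ), 1 < L → ∀ (i : Idx L) (ρ : ℝ) (U₀ : GaugeField (i.1.1.P i.1.2.2) 0 (Matrix.specialUnitaryGroup (Fin 2) ℂ)),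
      RegPr i.1.1 i.1.2.1 i.1.2.2 ρ U₀ → ρ ≤ α L → QuadAnalytic (Wf L i U₀) (C₄ L) (a₃ L))
    (norm_H₁ : ∀ (L : ℕ), 1 < L → ∀ (i : Idx L) (ρ : ℝ) (U₀ : GaugeField (i.1.1.P i.1.2.2) 0 (Matrix.specialUnitaryGroup (Fin 2) ℂ)),
      RegPr i.1.1 i.1.2.1 i.1.2.2 ρ U₀ → ρ ≤ α L → ∀ b, ‖H₁f L i U₀ b‖ ≤ B₀ L * ‖b‖)
    -- (45)–(46)-twˢ AT ITS η-ORDER, against the chart of record `Q := QTwS U₀`, (45) in the projected form `IsLandauPrintS` (d): print's letter `H` — `QH = I`, `RD*H = 0` (45), `‖HY‖ ≤ B_H·η·‖Y‖` (46), η = L^{−(K−n)} (DISPLAYED; supplier of record: [Balaban1985BackgroundPropagators]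
    -- Thm 3.12 for `H` (3.126), (3.133) n = 0,1 ⊕ (2.61); T³ statement p607026 `normH₁_row_of_recordObligations` with `Hsel := Hk`; O(η) = pure scaling `H_route = η·H_print`)
    -- CURE (α) of the fourth located lettering defect (2026-08-28): the (45)–(46) operator is a NAMED top-level letter `Hf` (beside `𝒢f Wf H₁f`; supplier instantiates `Hf L i U₀ := H46 … U₀`)
    (Hf : ∀ (L : ℕ) (i : Idx L) (U₀ : GaugeField (i.1.1.P i.1.2.2) 0 (Matrix.specialUnitaryGroup (Fin 2) ℂ)),
      (PBond (i.1.1.P i.1.2.1) 0 → Matrix (Fin 2) (Fin 2) ℂ) →ₗ[ℂ] (PBond (i.1.1.P i.1.2.2) 0 → Matrix (Fin 2) (Fin 2) ℂ))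
    (BH : ℕ → ℝ)
    (h45 : ∀ (L : ℕ), 1 < L → ∀ (i : Idx L) (U₀ : GaugeField (i.1.1.P i.1.2.2) 0 (Matrix.specialUnitaryGroup (Fin 2) ℂ)), RegPr i.1.1 i.1.2.1 i.1.2.2 (α L) U₀ →
      ∀ Y, QTwS i.1.1 i.1.2.1 i.1.2.2 i.2.2.le U₀ (Hf L i U₀ Y) = Y)
    (h45L : ∀ (L : ℕ), 1 < L → ∀ (i : Idx L) (U₀ : GaugeField (i.1.1.P i.1.2.2) 0 (Matrix.specialUnitaryGroup (Fin 2) ℂ)), RegPr i.1.1 i.1.2.1 i.1.2.2 (α L) U₀ →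
      ∀ Y, IsLandauPrintS i.1.1 i.1.2.1 i.1.2.2 i.2.2.le (c₀ L) (cB L) U₀ (Hf L i U₀ Y))
    (h46₀ : ∀ (L : ℕ), 1 < L → ∀ (i : Idx L) (U₀ : GaugeField (i.1.1.P i.1.2.2) 0 (Matrix.specialUnitaryGroup (Fin 2) ℂ)), RegPr i.1.1 i.1.2.1 i.1.2.2 (α L) U₀ →
      ∀ Y, ‖Hf L i U₀ Y‖ ≤ BH L * eta i.1.1 i.1.2.1 i.1.2.2 * ‖Y‖)
    (hHfR : ∀ (L : ℕ), 1 < L → ∀ (i : Idx L) (U₀ : GaugeField (i.1.1.P i.1.2.2) 0 (Matrix.specialUnitaryGroup (Fin 2) ℂ)), RegPr i.1.1 i.1.2.1 i.1.2.2 (α L) U₀ →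
      ∀ Y, (∀ c, star (Y c) = -Y c ∧ (Y c).trace = 0) → ∀ b', star (Hf L i U₀ Y b') = -Hf L i U₀ Y b' ∧ (Hf L i U₀ Y b').trace = 0)
    -- the radius `e L` of the witness ∕ window theorems and the two L-only numerals (WF) of W3 ∕ W5 ∕ the witness (replace (WΣ))
    (ef : ℕ → ℝ) (hef : ∀ L, 1 < L → 0 < ef L)
    (hWe : ∀ L : ℕ, 1 < L → 10 ^ 9 * (L : ℝ) ^ 2 * ef L ≤ 1) (hWε : ∀ L : ℕ, 1 < L → 10 ^ 12 * (L : ℝ) ^ 3 * α L ≤ 1)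
    -- the size window linking (CH5EL-twˢ)'s size row to the witness ∕ window radius, and the regularity window of the chart point
    (hMe : ∀ L, 1 < L → M L * α L < ef L)
    (hw137 : ∀ L : ℕ, 1 < L → 10 ^ 7 * (L : ℝ) ^ 3 * (178 * (α L + ef L)) ≤ 1)
    -- (CH47-twˢ) IS A THEOREM here (✓`Prop7CmapTwSymInputs.chart47twS_of_regPr_eta`): Prop. 3 for the chart of record at `C₂ := 40M₀ˢ∕(e·η)²`, `M₀ˢ = 6(2e + 2700Lε₀)`, radius `η·ε′`; its two η-free windows are displayed
    (ε' : ℕ → ℝ) (hBH0 : ∀ L : ℕ, 1 < L → 0 ≤ BH L)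
    (hq47 : ∀ L : ℕ, 1 < L → 9 * (40 * (2 * (3 * (2 * ef L + 2700 * (L : ℝ) * α L))) / ef L ^ 2) * BH L * ε' L < 1)
    (hR6 : ∀ L : ℕ, 1 < L → 6 * ε' L ≤ ef L)
    -- (102)-twS «Q𝔊 = 0» and (129)-twS «QH₁ = id» for print's `Q(U₀) = η·(QTwS U₀ ∘ ι)`, read through the (115)-space dictionary `ι` (DISPLAYED, N06-class rows about the opaque letters)
    (h102 : ∀ (L : ℕ), 1 < L → ∀ (i : Idx L) (U₀ : GaugeField (i.1.1.P i.1.2.2) 0 (Matrix.specialUnitaryGroup (Fin 2) ℂ)), RegPr i.1.1 i.1.2.1 i.1.2.2 (α L) U₀ →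
      ∀ f : NegSize (i.1.1.L : ℝ) (((i.1.1.L : ℝ)⁻¹) ^ (i.1.2.2 - i.1.2.1)) (fun _ : Bond 3 (periodsT3 i.1.1 i.1.2.2) => i.1.2.2 - i.1.2.1) 3 (Matrix (Fin 2) (Fin 2) ℂ),
        QTwS i.1.1 i.1.2.1 i.1.2.2 i.2.2.le U₀ (fun b : PBond (i.1.1.P i.1.2.2) 0 => JetSup.equiv _ _ _ (𝒢f L i U₀ f) (bondEquiv i.1.1 i.1.2.2 b)) = 0)
    (h129 : ∀ (L : ℕ), 1 < L → ∀ (i : Idx L) (U₀ : GaugeField (i.1.1.P i.1.2.2) 0 (Matrix.specialUnitaryGroup (Fin 2) ℂ)), RegPr i.1.1 i.1.2.1 i.1.2.2 (α L) U₀ →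
      ∀ B : PBond (i.1.1.P i.1.2.1) 0 → Matrix (Fin 2) (Fin 2) ℂ,
        QTwS i.1.1 i.1.2.1 i.1.2.2 i.2.2.le U₀ (fun b : PBond (i.1.1.P i.1.2.2) 0 => JetSup.equiv _ _ _ (H₁f L i U₀ B) (bondEquiv i.1.1 i.1.2.2 b)) =
          fun c => (((eta i.1.1 i.1.2.1 i.1.2.2 : ℝ) : ℂ))⁻¹ • B c)
    -- (102)-L «R_S D*𝔊 = 0» and (129)-L «R_S D*H₁ = 0» ((3.124)-S) in the projected form `IsLandauPrintS` (d), read through `ι` (DISPLAYED; definitional for the S suppliers)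
    (h102L : ∀ (L : ℕ), 1 < L → ∀ (i : Idx L) (U₀ : GaugeField (i.1.1.P i.1.2.2) 0 (Matrix.specialUnitaryGroup (Fin 2) ℂ)), RegPr i.1.1 i.1.2.1 i.1.2.2 (α L) U₀ →
      ∀ f : NegSize (i.1.1.L : ℝ) (((i.1.1.L : ℝ)⁻¹) ^ (i.1.2.2 - i.1.2.1)) (fun _ : Bond 3 (periodsT3 i.1.1 i.1.2.2) => i.1.2.2 - i.1.2.1) 3 (Matrix (Fin 2) (Fin 2) ℂ),
        IsLandauPrintS i.1.1 i.1.2.1 i.1.2.2 i.2.2.le (c₀ L) (cB L) U₀ (fun b : PBond (i.1.1.P i.1.2.2) 0 => JetSup.equiv _ _ _ (𝒢f L i U₀ f) (bondEquiv i.1.1 i.1.2.2 b)))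
    (h129L : ∀ (L : ℕ), 1 < L → ∀ (i : Idx L) (U₀ : GaugeField (i.1.1.P i.1.2.2) 0 (Matrix.specialUnitaryGroup (Fin 2) ℂ)), RegPr i.1.1 i.1.2.1 i.1.2.2 (α L) U₀ →
      ∀ B : PBond (i.1.1.P i.1.2.1) 0 → Matrix (Fin 2) (Fin 2) ℂ,
        IsLandauPrintS i.1.1 i.1.2.1 i.1.2.2 i.2.2.le (c₀ L) (cB L) U₀ (fun b : PBond (i.1.1.P i.1.2.2) 0 => JetSup.equiv _ _ _ (H₁f L i U₀ B) (bondEquiv i.1.1 i.1.2.2 b)))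
    -- the chart-radius window (exponent scale): print's `A′ = A₁ + H₁B` of (103) lies in the `ε₃`-ball of Prop. 3-tw, `η(r + 2B₀α) ≤ ε₃`
    (hrε : ∀ L : ℕ, 1 < L → r L + 2 * B₀ L * α L ≤ ε' L)
    -- (R-H₁) the letter `H₁(U₀)` is REAL: Hermitian-traceless data ↦ Hermitian-traceless-valued (115)-fields (DISPLAYED, N06-class clause on the `norm_H₁` letter)
    (hH₁R : ∀ (L : ℕ), 1 < L → ∀ (i : Idx L) (U₀ : GaugeField (i.1.1.P i.1.2.2) 0 (Matrix.specialUnitaryGroup (Fin 2) ℂ)), RegPr i.1.1 i.1.2.1 i.1.2.2 (α L) U₀ →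
      ∀ B : PBond (i.1.1.P i.1.2.1) 0 → Matrix (Fin 2) (Fin 2) ℂ, (∀ c, (B c).IsHermitian ∧ (B c).trace = 0) →
        ∀ b' : PBond (i.1.1.P i.1.2.2) 0, (JetSup.equiv _ _ _ (H₁f L i U₀ B) (bondEquiv i.1.1 i.1.2.2 b')).IsHermitian ∧
          (JetSup.equiv _ _ _ (H₁f L i U₀ B) (bondEquiv i.1.1 i.1.2.2 b')).trace = 0)
    -- (R-𝒢) the letter `𝔊(U₀)` is REAL: Hermitian-traceless (−3)-data ↦ Hermitian-traceless (115)-fields (DISPLAYED, N06-class clause on the `norm_G` letter)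
    (h𝒢R : ∀ (L : ℕ), 1 < L → ∀ (i : Idx L) (U₀ : GaugeField (i.1.1.P i.1.2.2) 0 (Matrix.specialUnitaryGroup (Fin 2) ℂ)), RegPr i.1.1 i.1.2.1 i.1.2.2 (α L) U₀ →
      ∀ f : NegSize (i.1.1.L : ℝ) (((i.1.1.L : ℝ)⁻¹) ^ (i.1.2.2 - i.1.2.1)) (fun _ : Bond 3 (periodsT3 i.1.1 i.1.2.2) => i.1.2.2 - i.1.2.1) 3 (Matrix (Fin 2) (Fin 2) ℂ),
        (∀ b, (NegSup.equiv _ _ f b).IsHermitian ∧ (NegSup.equiv _ _ f b).trace = 0) →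
        ∀ b, (JetSup.equiv _ _ _ (𝒢f L i U₀ f) b).IsHermitian ∧ (JetSup.equiv _ _ _ (𝒢f L i U₀ f) b).trace = 0)
    -- (R-W) the letter `(δ∕δA′)V` is REAL on its ball: Hermitian-traceless (115)-fields ↦ Hermitian-traceless (−3)-data (DISPLAYED, P4-class clause on the `prop4` letter)
    (hWR : ∀ (L : ℕ), 1 < L → ∀ (i : Idx L) (U₀ : GaugeField (i.1.1.P i.1.2.2) 0 (Matrix.specialUnitaryGroup (Fin 2) ℂ)), RegPr i.1.1 i.1.2.1 i.1.2.2 (α L) U₀ →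
      ∀ A : Space115 (i.1.1.L : ℝ) (((i.1.1.L : ℝ)⁻¹) ^ (i.1.2.2 - i.1.2.1)) (fun _ : Bond 3 (periodsT3 i.1.1 i.1.2.2) => i.1.2.2 - i.1.2.1)
          (fun _ : Bond 3 (periodsT3 i.1.1 i.1.2.2) × Fin 3 => i.1.2.2 - i.1.2.1) (nabla115 (((i.1.1.L : ℝ)⁻¹) ^ (i.1.2.2 - i.1.2.1)) (bgOfCfg i.1.1 i.1.2.2 U₀)),
        ‖A‖ < a₃ L → (∀ b, (JetSup.equiv _ _ _ A b).IsHermitian ∧ (JetSup.equiv _ _ _ A b).trace = 0) →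
        ∀ b, (NegSup.equiv _ _ (Wf L i U₀ A) b).IsHermitian ∧ (NegSup.equiv _ _ (Wf L i U₀ A) b).trace = 0)
    -- the three `L`-only windows putting `ε₄ := r` in Prop. 6's uniqueness regime (118)∕(121)
    (hrα : ∀ L : ℕ, 1 < L → 2 * B₀ L * α L ≤ r L) (hr4 : ∀ L : ℕ, 1 < L → 4 * r L ≤ a₃ L) (hr16 : ∀ L : ℕ, 1 < L → 16 * B₀ L * C₄ L * r L ≤ 1)
    -- (CH5EL-twˢ)‴: (112) ∘ (123)–(140) ((19)-size) ∘ E–L (at the `NormS`-representatives) at print's `A′ = A₁ + H₁B` in the exponent scale `iη·(ι A₁ + ι(H₁B))`, for the REAL `H` of (45)–(46)-twˢ, chart remainder `Dfix (CmapTwS U₀)` (DISPLAYED, XL; no (20), (21), datum, NO REALITY — Prop. 5's «X is 𝔤-valued» is now proved)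
    (hXtw''' : ∀ (L : ℕ), 1 < L → ∀ (i : Idx L) (ε₁ : ℝ) (V : GaugeField (i.1.1.P i.1.2.1) 0 (Matrix.specialUnitaryGroup (Fin 2) ℂ))
      (U₀ : GaugeField (i.1.1.P i.1.2.2) 0 (Matrix.specialUnitaryGroup (Fin 2) ℂ)), 0 < ε₁ → PlaqSmall ε₁ V →
      RegPr i.1.1 i.1.2.1 i.1.2.2 ((L : ℝ) ^ 3 * (3 * (L : ℝ)) * ε₁) U₀ → CloseAvg i.1.1 i.1.2.1 i.1.2.2 i.2.2.le ((L : ℝ) ^ 3 * ε₁) V U₀ → (L : ℝ) ^ 3 * (3 * (L : ℝ)) * ε₁ ≤ α L →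
      ∀ A₁ : Space115 (i.1.1.L : ℝ) (((i.1.1.L : ℝ)⁻¹) ^ (i.1.2.2 - i.1.2.1)) (fun _ : Bond 3 (periodsT3 i.1.1 i.1.2.2) => i.1.2.2 - i.1.2.1)
          (fun _ : Bond 3 (periodsT3 i.1.1 i.1.2.2) × Fin 3 => i.1.2.2 - i.1.2.1) (nabla115 (((i.1.1.L : ℝ)⁻¹) ^ (i.1.2.2 - i.1.2.1)) (bgOfCfg i.1.1 i.1.2.2 U₀)),
        ‖A₁‖ < r L →
        A₁ + 𝒢f L i U₀ (Jcur (bgOfCfg i.1.1 i.1.2.2 U₀)) + 𝒢f L i U₀ (Wf L i U₀ (A₁ + H₁f L i U₀ (fun c : PBond (i.1.1.P i.1.2.1) 0 =>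
          (-Complex.I) • mlog (((V c : Matrix.specialUnitaryGroup (Fin 2) ℂ) : Matrix (Fin 2) (Fin 2) ℂ)
            * star ((descendTo i.1.1 ℰp i.1.2.1 i.1.2.2 i.2.2.le U₀ c : Matrix.specialUnitaryGroup (Fin 2) ℂ) : Matrix (Fin 2) (Fin 2) ℂ))))) = 0 →
        ∃ X : PBond (i.1.1.P i.1.2.2) 0 → Matrix (Fin 2) (Fin 2) ℂ,
          (((eta i.1.1 i.1.2.1 i.1.2.2 : ℝ) : ℂ) * Complex.I) • ((fun b : PBond (i.1.1.P i.1.2.2) 0 => JetSup.equiv _ _ _ A₁ (bondEquiv i.1.1 i.1.2.2 b))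
              + (fun b : PBond (i.1.1.P i.1.2.2) 0 => JetSup.equiv _ _ _ (H₁f L i U₀ (fun c : PBond (i.1.1.P i.1.2.1) 0 =>
          (-Complex.I) • mlog (((V c : Matrix.specialUnitaryGroup (Fin 2) ℂ) : Matrix (Fin 2) (Fin 2) ℂ)
            * star ((descendTo i.1.1 ℰp i.1.2.1 i.1.2.2 i.2.2.le U₀ c : Matrix.specialUnitaryGroup (Fin 2) ℂ) : Matrix (Fin 2) (Fin 2) ℂ)))) (bondEquiv i.1.1 i.1.2.2 b)))
            - Hf L i U₀ (Dfix (CmapTwS i.1.1 i.1.2.1 i.1.2.2 i.2.2.le U₀) (Hf L i U₀) (40 * (2 * (3 * (2 * ef L + 2700 * (i.1.1.L : ℝ) * α L))) / (ef L * eta i.1.1 i.1.2.1 i.1.2.2) ^ 2)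
              ((((eta i.1.1 i.1.2.1 i.1.2.2 : ℝ) : ℂ) * Complex.I) • ((fun b : PBond (i.1.1.P i.1.2.2) 0 => JetSup.equiv _ _ _ A₁ (bondEquiv i.1.1 i.1.2.2 b))
              + (fun b : PBond (i.1.1.P i.1.2.2) 0 => JetSup.equiv _ _ _ (H₁f L i U₀ (fun c : PBond (i.1.1.P i.1.2.1) 0 =>
          (-Complex.I) • mlog (((V c : Matrix.specialUnitaryGroup (Fin 2) ℂ) : Matrix (Fin 2) (Fin 2) ℂ)
            * star ((descendTo i.1.1 ℰp i.1.2.1 i.1.2.2 i.2.2.le U₀ c : Matrix.specialUnitaryGroup (Fin 2) ℂ) : Matrix (Fin 2) (Fin 2) ℂ)))) (bondEquiv i.1.1 i.1.2.2 b)))))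
            = (fun b => Complex.I • X b) ∧
          nMax19 i.1.1 i.1.2.1 i.1.2.2 U₀ X ≤ M L * ((L : ℝ) ^ 3 * (3 * (L : ℝ)) * ε₁) ∧
          (∀ u : GaugeTransf (i.1.1.P i.1.2.2) 0 (Matrix.specialUnitaryGroup (Fin 2) ℂ), NormS i.1.1 i.1.2.1 i.1.2.2 i.2.2.le U₀ X (expHermField X) u →
            GaugeField.gaugeAct u (emb15 U₀ (expHermField X)) ∈ fibre i.1.1 ℰp i.1.2.1 i.1.2.2 i.2.2.le V →
            ∀ γ : ℝ → GaugeField (i.1.1.P i.1.2.2) 0 (Matrix.specialUnitaryGroup (Fin 2) ℂ), γ 0 = GaugeField.gaugeAct u (emb15 U₀ (expHermField X)) →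
              (∀ t, γ t ∈ fibre i.1.1 ℰp i.1.2.1 i.1.2.2 i.2.2.le V) →
              (∀ b, DifferentiableAt ℝ (fun t => ((γ t b : Matrix.specialUnitaryGroup (Fin 2) ℂ) : Matrix (Fin 2) (Fin 2) ℂ)) 0) →
                deriv (fun t => wilsonAction4 (γ t)) 0 = 0))
    -- the slice at the critical background `W`, OPAQUE (print's linear Landau slice `{QA′ = 0, RD*A′ = 0}` at background `W` read through (47), SIZES INCLUDED; the α-P lane's letter)
    (Tsl : ∀ (L : ℕ) (i : Idx L), GaugeField (i.1.1.P i.1.2.2) 0 (Matrix.specialUnitaryGroup (Fin 2) ℂ) → Set (PBond (i.1.1.P i.1.2.2) 0 → Matrix (Fin 2) (Fin 2) ℂ))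
    -- (ii-a) CHART_W at the critical background `W = (e^{iX}U₀)^u`: every admissible competitor has the action of a chart point `e^{iD}W`, `D` in the slice `Tsl L i W` (all size information lives in
    -- the opaque slice letter) — [Balaban1985RegularSpaces] Thm 2 + (47) at background `W` + gauge invariance of (5), DISPLAYED
    (hChartW : ∀ (L : ℕ), 1 < L → ∀ (i : Idx L) (ε₁ ε₄ : ℝ) (V : GaugeField (i.1.1.P i.1.2.1) 0 (Matrix.specialUnitaryGroup (Fin 2) ℂ))
      (U₀ : GaugeField (i.1.1.P i.1.2.2) 0 (Matrix.specialUnitaryGroup (Fin 2) ℂ)) (X : PBond (i.1.1.P i.1.2.2) 0 → Matrix (Fin 2) (Fin 2) ℂ)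
      (u : GaugeTransf (i.1.1.P i.1.2.2) 0 (Matrix.specialUnitaryGroup (Fin 2) ℂ)) (W : GaugeField (i.1.1.P i.1.2.2) 0 (Matrix.specialUnitaryGroup (Fin 2) ℂ)),
      0 < ε₁ → ε₄ ≤ 1 / 4 → ε₄ ≤ aW L → (L : ℝ) ^ 3 * (3 * (L : ℝ)) * ε₁ ≤ ε₄ → PlaqSmall ε₁ V → RegPr i.1.1 i.1.2.1 i.1.2.2 ((L : ℝ) ^ 3 * (3 * (L : ℝ)) * ε₁) U₀ →
      CloseAvg i.1.1 i.1.2.1 i.1.2.2 i.2.2.le ((L : ℝ) ^ 3 * ε₁) V U₀ → (∀ b : PBond (i.1.1.P i.1.2.2) 0, (X b).IsHermitian ∧ Matrix.trace (X b) = 0) →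
      nMax19 i.1.1 i.1.2.1 i.1.2.2 U₀ X < ε₄ → AvgCondPrintS i.1.1 i.1.2.1 i.1.2.2 i.2.2.le V U₀ X → IsLandauPrintS i.1.1 i.1.2.1 i.1.2.2 i.2.2.le (c₀ L) (cB L) U₀ X →
      NormS i.1.1 i.1.2.1 i.1.2.2 i.2.2.le U₀ X (expHermField X) u → W = GaugeField.gaugeAct u (emb15 U₀ (expHermField X)) →
      W ∈ fibre i.1.1 ℰp i.1.2.1 i.1.2.2 i.2.2.le V →
      (∀ γ : ℝ → GaugeField (i.1.1.P i.1.2.2) 0 (Matrix.specialUnitaryGroup (Fin 2) ℂ), γ 0 = W → (∀ t, γ t ∈ fibre i.1.1 ℰp i.1.2.1 i.1.2.2 i.2.2.le V) →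
        (∀ b, DifferentiableAt ℝ (fun t => ((γ t b : Matrix.specialUnitaryGroup (Fin 2) ℂ) : Matrix (Fin 2) (Fin 2) ℂ)) 0) →
          deriv (fun t => wilsonAction4 (γ t)) 0 = 0) →
      ∀ X' : PBond (i.1.1.P i.1.2.2) 0 → Matrix (Fin 2) (Fin 2) ℂ, nMax19 i.1.1 i.1.2.1 i.1.2.2 U₀ X' < ε₄ →
        (∀ b : PBond (i.1.1.P i.1.2.2) 0, (X' b).IsHermitian ∧ Matrix.trace (X' b) = 0) →
          AvgCondPrint i.1.1 i.1.2.1 i.1.2.2 i.2.2.le V U₀ X' → IsLandauPrint i.1.1 i.1.2.1 i.1.2.2 U₀ X' →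
            ∃ D ∈ Tsl L i W, (∀ b : PBond (i.1.1.P i.1.2.2) 0, (D b).IsHermitian ∧ Matrix.trace (D b) = 0) ∧
              wilsonAction4 (emb15 U₀ (expHermField X')) = wilsonAction4 (emb15 W (expHermField D)))
    -- (ii-b) LOCMIN_W: `W` is a minimum of the action along the charted slice — (141)–(142) at the critical background: first variation = 0 on the linear slice, second variation
    -- `½⟨A′, Δ₁A′⟩` positive definite, third order absorbed (DISPLAYED; the α-P lane's row: TAYLOR ∧ EL_W ∧ HESS_W in their scale-aware shapes ⟹ LOCMIN_W)
    (hLocW : ∀ (L : ℕ), 1 < L → ∀ (i : Idx L) (ε₁ ε₄ : ℝ) (V : GaugeField (i.1.1.P i.1.2.1) 0 (Matrix.specialUnitaryGroup (Fin 2) ℂ))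
      (U₀ : GaugeField (i.1.1.P i.1.2.2) 0 (Matrix.specialUnitaryGroup (Fin 2) ℂ)) (X : PBond (i.1.1.P i.1.2.2) 0 → Matrix (Fin 2) (Fin 2) ℂ)
      (u : GaugeTransf (i.1.1.P i.1.2.2) 0 (Matrix.specialUnitaryGroup (Fin 2) ℂ)) (W : GaugeField (i.1.1.P i.1.2.2) 0 (Matrix.specialUnitaryGroup (Fin 2) ℂ)),
      0 < ε₁ → ε₄ ≤ 1 / 4 → ε₄ ≤ aW L → (L : ℝ) ^ 3 * (3 * (L : ℝ)) * ε₁ ≤ ε₄ → PlaqSmall ε₁ V → RegPr i.1.1 i.1.2.1 i.1.2.2 ((L : ℝ) ^ 3 * (3 * (L : ℝ)) * ε₁) U₀ →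
      CloseAvg i.1.1 i.1.2.1 i.1.2.2 i.2.2.le ((L : ℝ) ^ 3 * ε₁) V U₀ → (∀ b : PBond (i.1.1.P i.1.2.2) 0, (X b).IsHermitian ∧ Matrix.trace (X b) = 0) →
      nMax19 i.1.1 i.1.2.1 i.1.2.2 U₀ X < ε₄ → AvgCondPrintS i.1.1 i.1.2.1 i.1.2.2 i.2.2.le V U₀ X → IsLandauPrintS i.1.1 i.1.2.1 i.1.2.2 i.2.2.le (c₀ L) (cB L) U₀ X →
      NormS i.1.1 i.1.2.1 i.1.2.2 i.2.2.le U₀ X (expHermField X) u → W = GaugeField.gaugeAct u (emb15 U₀ (expHermField X)) →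
      W ∈ fibre i.1.1 ℰp i.1.2.1 i.1.2.2 i.2.2.le V →
      (∀ γ : ℝ → GaugeField (i.1.1.P i.1.2.2) 0 (Matrix.specialUnitaryGroup (Fin 2) ℂ), γ 0 = W → (∀ t, γ t ∈ fibre i.1.1 ℰp i.1.2.1 i.1.2.2 i.2.2.le V) →
        (∀ b, DifferentiableAt ℝ (fun t => ((γ t b : Matrix.specialUnitaryGroup (Fin 2) ℂ) : Matrix (Fin 2) (Fin 2) ℂ)) 0) →
          deriv (fun t => wilsonAction4 (γ t)) 0 = 0) →
      ∀ D ∈ Tsl L i W, (∀ b : PBond (i.1.1.P i.1.2.2) 0, (D b).IsHermitian ∧ Matrix.trace (D b) = 0) →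
        wilsonAction4 W ≤ wilsonAction4 (emb15 W (expHermField D)))
    -- (T2) the [B8] Thm 2 sockets AT THE SETUP-TORUS OBJECTS (`Thm2SetupSUAt`, rider dropped), one `(B₁, c₁)` per `L` (v3.2ˢ currency)
    (hThm2S : ∀ (L : ℕ), 1 < L → ∃ B₁ c₁ : ℝ, 0 < B₁ ∧ 0 < c₁ ∧ ∀ (F : T3Family), F.L = L → ∀ (n K : ℕ), n < K →
      ∃ (β₀ B₂ : ℝ) (len : B7Prop1Explicit.Site (F.P K).d → ℝ),
        Thm2SetupSUAt (F.P K) 2 (K - n) (eta F n K) β₀ B₁ B₂ c₁ len (fun _ => True)) :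
    ∀ (L : ℕ), 1 < L → ∀ (B₃ : ℝ), 4 < B₃ → ∃ a₁' O₁ : ℝ, 0 < a₁' ∧ 1 ≤ O₁ ∧
    ∀ (F : T3Family), F.L = L → ∀ (n K : ℕ) (hnK : n < K) (ε₁ : ℝ), 0 < ε₁ →
      ∀ V : GaugeField (F.P n) 0 (Matrix.specialUnitaryGroup (Fin 2) ℂ), PlaqSmall ε₁ V →
        ∀ U₀ : GaugeField (F.P K) 0 (Matrix.specialUnitaryGroup (Fin 2) ℂ), RegPr F n K ((L : ℝ) ^ 3 * B₃ * ε₁) U₀ → U₀ ∈ fibre F ℰp n K hnK.le V →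
          ε₁ ≤ a₁' → ∃ U ∈ regFibrePr F n K hnK.le (O₁ * (L : ℝ) ^ 3 * B₃ * ε₁) V,
            IsMinOn (fun W : GaugeField (F.P K) 0 (Matrix.specialUnitaryGroup (Fin 2) ℂ) => wilsonAction4 W)
              (regFibrePr F n K hnK.le (O₁ * (L : ℝ) ^ 3 * B₃ * ε₁) V) U := by
  -- `stubEX_of_displayedRows_wWS` at `Lan := IsLandauPrintS (c₀ L) (cB L)`, chart of record, `β := Λ_k`, `B := Bsym`; two rows to discharge: (B20) and CHART-112ˢ ((R-A₁) by `hA₁R_of_letterReality`)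
  refine stubEX_of_displayedRows_wWSE
    (fun (L : ℕ) (i : Idx L) (U₀ : GaugeField (i.1.1.P i.1.2.2) 0 (Matrix.specialUnitaryGroup (Fin 2) ℂ)) (X : PBond (i.1.1.P i.1.2.2) 0 → Matrix (Fin 2) (Fin 2) ℂ) =>
      IsLandauPrintS i.1.1 i.1.2.1 i.1.2.2 i.2.2.le (c₀ L) (cB L) U₀ X)
    (fun L i => periodsT3 i.1.1 i.1.2.2) (fun L i => siteEquiv i.1.1 i.1.2.2) (fun L i x μ => siteEquiv_shiftEquiv i.1.1 i.1.2.2 x μ)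
    B₀ C₄ a₃ α r M aW hB₀ hC₄ ha₃ hα hr haW 𝒢f Wf (fun L i => PBond (i.1.1.P i.1.2.1) 0) H₁f
    (fun L i V U₀ => fun c : PBond (i.1.1.P i.1.2.1) 0 =>
      (-Complex.I) • mlog (((V c : Matrix.specialUnitaryGroup (Fin 2) ℂ) : Matrix (Fin 2) (Fin 2) ℂ)
        * star ((descendTo i.1.1 ℰp i.1.2.1 i.1.2.2 i.2.2.le U₀ c : Matrix.specialUnitaryGroup (Fin 2) ℂ) : Matrix (Fin 2) (Fin 2) ℂ)))
    Tsl norm_G prop4 norm_H₁ ?_ ?_ hChartW hLocW hThm2S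
  · -- (B20) DISCHARGED at the letter `Bsym` (★w4-19200 g2), window `L³ε₁ ≤ α∕(3L) ≤ 1∕48` from WS `2α ≤ ⅛`
    intro L hL i ε₁ V U₀ hε₁ _hV _hreg hclose hαe
    have hFL' : (i.1.1.L : ℝ) = (L : ℝ) := by exact_mod_cast i.2.1
    have hL1 : (1 : ℝ) ≤ (L : ℝ) := by exact_mod_cast hL.le
    have s3 : 2 * α L ≤ 1 / 8 :=
      (windows_of_W (by rw [← hFL']; exact three_le_memberL i) (hα L hL).le (hef L hL).le (hWe L hL) (hWε L hL)).1
    have hwin : (i.1.1.L : ℝ) ^ 3 * ε₁ ≤ 1 / 2 := by rw [hFL']; exact (windows_of_admissible hL1 hε₁.le hαe s3).1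
    have hclose' : CloseAvg i.1.1 i.1.2.1 i.1.2.2 i.2.2.le ((i.1.1.L : ℝ) ^ 3 * ε₁) V U₀ := by rw [hFL']; exact hclose
    have hB := bound20_symLog_of_closeAvg i.1.1 i.2.2.le hε₁ hwin V U₀ hclose'
    have hrad : (i.1.1.L : ℝ) ^ 3 * ε₁ = (L : ℝ) ^ 3 * ε₁ := by rw [hFL']
    rw [hrad] at hB
    exact hB
  · -- CHART-112ˢ DISCHARGED: (46)-twˢ ∃H, Prop. 3 for the chart of record (W5), the witness row, the window (W3), the member-level knit `hChart_of_piecesTwS`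
    intro L hL i ε₁ V U₀ hε₁ hV hreg hclose hαe A₁ hA₁ hsol
    have hFL' : (i.1.1.L : ℝ) = (L : ℝ) := by exact_mod_cast i.2.1
    have hL0 : (0 : ℝ) < (L : ℝ) := by exact_mod_cast (show 0 < L by omega)
    have hL1 : (1 : ℝ) ≤ (L : ℝ) := by exact_mod_cast hL.le
    have hL3 : (3 : ℝ) ≤ (L : ℝ) := by rw [← hFL']; exact three_le_memberL i
    obtain ⟨s3, s4⟩ := windows_of_W hL3 (hα L hL).le (hef L hL).le (hWe L hL) (hWε L hL)
    have hWe' : 10 ^ 9 * (i.1.1.L : ℝ) ^ 2 * ef L ≤ 1 := by rw [hFL']; exact hWe L hL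
    have hWε' : 10 ^ 12 * (i.1.1.L : ℝ) ^ 3 * α L ≤ 1 := by rw [hFL']; exact hWε L hL
    -- the background at the window radius `α L`
    have hregα : RegPr i.1.1 i.1.2.1 i.1.2.2 (α L) U₀ := regPr_mono i.1.1 hαe hreg
    -- (46)-twˢ and Prop. 3 at this background
    have hQH := h45 L hL i U₀ hregα
    have h45H := h45L L hL i U₀ hregα
    have hHB := h46₀ L hL i U₀ hregα
    have hHR := hHfR L hL i U₀ hregα
    -- (CH47-twˢ) DISCHARGED: ★w4-20520 g3's W5 `chart47twS_of_regPr_eta` in (WF) `hWe`∕`hWε`, (W47q), (W47R)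
    have hα0 : 0 < α L := hα L hL
    have he0 : 0 < ef L := hef L hL
    have hw137' : 10 ^ 7 * (i.1.1.L : ℝ) ^ 3 * (178 * (α L + ef L)) ≤ 1 := by rw [hFL']; exact hw137 L hL
    have h47 : Chart47T3twS i.1.1 i.1.2.1 i.1.2.2 i.2.2.le (40 * (2 * (3 * (2 * ef L + 2700 * (i.1.1.L : ℝ) * α L))) / (ef L * eta i.1.1 i.1.2.1 i.1.2.2) ^ 2)
        (eta i.1.1 i.1.2.1 i.1.2.2 * ε' L) U₀ (Hf L i U₀) := by
      have hq : 9 * (40 * (2 * (3 * (2 * ef L + 2700 * (i.1.1.L : ℝ) * α L))) / ef L ^ 2) * BH L * ε' L < 1 := by rw [hFL']; exact hq47 L hL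
      exact chart47twS_of_regPr_eta i.1.1 i.2.2.le hα0 he0 hWe' hWε' U₀ hregα (hBH0 L hL) hHB hq (hR6 L hL)
    -- CHART-ΣS WITNESS (★w5-20520 g4's THEOREM `exists_normS_of_regPr_of_size`; the chart point is printed-regular of radius `178(α + e)` by [Balaban1985RegularSpaces] Prop. 7)
    have hWit' : ∀ X : PBond (i.1.1.P i.1.2.2) 0 → Matrix (Fin 2) (Fin 2) ℂ, (∀ b : PBond (i.1.1.P i.1.2.2) 0, (X b).IsHermitian ∧ Matrix.trace (X b) = 0) →
        nMax19 i.1.1 i.1.2.1 i.1.2.2 U₀ X < ef L →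
        ∃ u : GaugeTransf (i.1.1.P i.1.2.2) 0 (Matrix.specialUnitaryGroup (Fin 2) ℂ), NormS i.1.1 i.1.2.1 i.1.2.2 i.2.2.le U₀ X (expHermField X) u := by
      intro X hX hlt
      have hε₂ : α L + ef L ≤ 1 / 4 := by linarith
      have h19 : In19 i.1.1 i.1.2.1 i.1.2.2 (α L + ef L) U₀ (expHermField X) X := in19_expHermField_of_nMax19_lt hX (hlt.trans_le (by linarith))
      have hU₁ : RegPr i.1.1 i.1.2.1 i.1.2.2 (178 * (α L + ef L)) (emb15 U₀ (expHermField X)) :=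
        regPr_emb15_of_in19 i.1.1 i.1.2.1 i.1.2.2 hε₂ (by linarith) hregα h19
      have hXe : ∀ b : PBond (i.1.1.P i.1.2.2) 0, ‖X b‖ ≤ ef L * eta i.1.1 i.1.2.1 i.1.2.2 := fun b => by
        have h1 := norm_smul_I_le_of_nMax19_lt i.1.1 hlt b
        rwa [norm_smul, Complex.norm_I, one_mul] at h1
      exact exists_normS_of_regPr_of_size i.1.1 i.2.2.le hα0 hWε' (by positivity) hw137' he0.le hWe' hregα hX hXe hU₁
    -- ‖H₁B‖ ≤ 2B₀α from `norm_H₁` ∘ (B20) and `L³·3L·ε₁ ≤ α`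
    have hwin : (i.1.1.L : ℝ) ^ 3 * ε₁ ≤ 1 / 2 := by rw [hFL']; exact (windows_of_admissible hL1 hε₁.le hαe s3).1
    have hclose' : CloseAvg i.1.1 i.1.2.1 i.1.2.2 i.2.2.le ((i.1.1.L : ℝ) ^ 3 * ε₁) V U₀ := by rw [hFL']; exact hclose
    have hB := bound20_symLog_of_closeAvg i.1.1 i.2.2.le hε₁ hwin V U₀ hclose'
    have hH₁B : ‖H₁f L i U₀ (fun c : PBond (i.1.1.P i.1.2.1) 0 =>
        (-Complex.I) • mlog (((V c : Matrix.specialUnitaryGroup (Fin 2) ℂ) : Matrix (Fin 2) (Fin 2) ℂ)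
          * star ((descendTo i.1.1 ℰp i.1.2.1 i.1.2.2 i.2.2.le U₀ c : Matrix.specialUnitaryGroup (Fin 2) ℂ) : Matrix (Fin 2) (Fin 2) ℂ)))‖ ≤ 2 * B₀ L * α L := by
      have h0 := norm_H₁ L hL i _ U₀ hreg hαe (fun c : PBond (i.1.1.P i.1.2.1) 0 =>
        (-Complex.I) • mlog (((V c : Matrix.specialUnitaryGroup (Fin 2) ℂ) : Matrix (Fin 2) (Fin 2) ℂ)
          * star ((descendTo i.1.1 ℰp i.1.2.1 i.1.2.2 i.2.2.le U₀ c : Matrix.specialUnitaryGroup (Fin 2) ℂ) : Matrix (Fin 2) (Fin 2) ℂ)))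
      have hB' : ‖(fun c : PBond (i.1.1.P i.1.2.1) 0 =>
          (-Complex.I) • mlog (((V c : Matrix.specialUnitaryGroup (Fin 2) ℂ) : Matrix (Fin 2) (Fin 2) ℂ)
            * star ((descendTo i.1.1 ℰp i.1.2.1 i.1.2.2 i.2.2.le U₀ c : Matrix.specialUnitaryGroup (Fin 2) ℂ) : Matrix (Fin 2) (Fin 2) ℂ)))‖ ≤ 2 * α L := by
        have h3 : 2 * ((3 : ℝ) * i.1.1.L) * ((i.1.1.L : ℝ) ^ 3 * ε₁) = 2 * ((L : ℝ) ^ 3 * (3 * (L : ℝ)) * ε₁) := by rw [hFL']; ring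
        rw [h3] at hB
        linarith
      calc _ ≤ B₀ L * _ := h0
        _ ≤ B₀ L * (2 * α L) := mul_le_mul_of_nonneg_left hB' (hB₀ L hL).le
        _ = 2 * B₀ L * α L := by ring
    -- the (19)-size window: `M·(L³·3L·ε₁) ≤ M·α < ef` (print's `ε₂ = O(1)·C₁B₃ε₁` below the witness ∕ window radius)
    have hMe' : M L * ((L : ℝ) ^ 3 * (3 * (L : ℝ)) * ε₁) < ef L :=
      lt_of_le_of_lt (mul_le_mul_of_nonneg_left hαe (hM L hL).le) (hMe L hL)
    -- the numeric windows of the member-level knit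
    obtain ⟨-, hb1, hα16⟩ := windows_of_admissible hL1 hε₁.le hαe s3
    -- the contraction regime of the reality junction in η-form: `9·C₂ˢ·(B_H η)·(η ε′) = 9·(40M₀ˢ∕e²)·B_H·ε′`, `6ηε′ ≤ eη`
    have hηpos : 0 < eta i.1.1 i.1.2.1 i.1.2.2 := T3SectALandauChart.eta_pos i.1.1 i.1.2.1 i.1.2.2
    have hq' : 9 * (40 * (2 * (3 * (2 * ef L + 2700 * (i.1.1.L : ℝ) * α L))) / (ef L * eta i.1.1 i.1.2.1 i.1.2.2) ^ 2)
        * (BH L * eta i.1.1 i.1.2.1 i.1.2.2) * (eta i.1.1 i.1.2.1 i.1.2.2 * ε' L) < 1 := by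
      have hcalc : 9 * (40 * (2 * (3 * (2 * ef L + 2700 * (i.1.1.L : ℝ) * α L))) / (ef L * eta i.1.1 i.1.2.1 i.1.2.2) ^ 2)
          * (BH L * eta i.1.1 i.1.2.1 i.1.2.2) * (eta i.1.1 i.1.2.1 i.1.2.2 * ε' L)
          = 9 * (40 * (2 * (3 * (2 * ef L + 2700 * (i.1.1.L : ℝ) * α L))) / ef L ^ 2) * BH L * ε' L := by
        field_simp
      rw [hcalc, hFL']; exact hq47 L hL
    have hRε' : 6 * (eta i.1.1 i.1.2.1 i.1.2.2 * ε' L) ≤ ef L * eta i.1.1 i.1.2.1 i.1.2.2 := by nlinarith [hR6 L hL]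
    -- (R-B) the pinned datum is Hermitian-traceless: `V·Ū₀* ∈ SU(2)` within `1∕3` of `1` ((14): `L³ε₁ ≤ α∕(3L) ≤ 1∕48`)
    have h13 : (i.1.1.L : ℝ) ^ 3 * ε₁ ≤ 1 / 3 := by
      rw [hFL']
      have h0 : 0 ≤ (L : ℝ) ^ 3 * ε₁ := by positivity
      have h1 : (L : ℝ) ^ 3 * (3 * (L : ℝ)) * ε₁ ≤ 1 / 16 := hαe.trans hα16
      nlinarith [mul_nonneg h0 (by linarith : (0 : ℝ) ≤ 3 * (L : ℝ) - 1)]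
    have hBR := bsym_isHermitian_trace_zero i.1.1 i.2.2.le V U₀ h13 hclose'
    -- (WIN-twˢ) DISCHARGED (★w4-20520 g3's W3 `dbarTwS_window_of_regPr`, ✓p617963) in (WF) `hWe`∕`hWε`
    have hwin : ∀ X : PBond (i.1.1.P i.1.2.2) 0 → Matrix (Fin 2) (Fin 2) ℂ, (∀ b : PBond (i.1.1.P i.1.2.2) 0, (X b).IsHermitian ∧ Matrix.trace (X b) = 0) →
        nMax19 i.1.1 i.1.2.1 i.1.2.2 U₀ X < ef L →
        ∀ c : PBond (i.1.1.P i.1.2.1) 0, ‖((dbarTwS i.1.1 i.1.2.1 i.1.2.2 i.2.2.le U₀ (fun b => Complex.I • X b) c : (Matrix (Fin 2) (Fin 2) ℂ)ˣ) : Matrix (Fin 2) (Fin 2) ℂ) - 1‖ < 1 :=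
      fun X _ hX c => (dbarTwS_window_of_regPr i.1.1 i.2.2.le (hα L hL) (hef L hL) hWe' hWε' U₀ hregα X hX c).2
    exact hChart_of_piecesTwG i.1.1 i.2.2.le (fun X : PBond (i.1.1.P i.1.2.2) 0 → Matrix (Fin 2) (Fin 2) ℂ => IsLandauPrintS i.1.1 i.1.2.1 i.1.2.2 i.2.2.le (c₀ L) (cB L) U₀ X)
      (hα L hL) hα16 (hef L hL) s4 hb1 hw137' hregα hclose h47 hQH hWit' hwin
      (hXtw_of_split_etaG i.1.1 i.2.2.le _ (h102 L hL i U₀ hregα) (h129 L hL i U₀ hregα) hH₁B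
        (mul_le_mul_of_nonneg_left (hrε L hL) (T3SectALandauChart.eta_pos i.1.1 i.1.2.1 i.1.2.2).le)
        -- (21)ˢ DISCHARGED through the generic Landau split at `IsLandauPrintS`: (102)-L, (129)-L and (45) for the chart's `H` (`IsLandauPrintS.add∕.smul`)
        (hXtw'_of_splitG i.1.1 i.2.2.le _ (fun _ _ hX hY => hX.add hY) (fun a _ hX => hX.smul a) (h102L L hL i U₀ hregα) (h129L L hL i U₀ hregα) h45H
          (hXtw''_of_reality i.1.1 i.2.2.le hα0 he0 hWe' hWε' hregα (mul_nonneg (hBH0 L hL) (T3SectALandauChart.eta_pos i.1.1 i.1.2.1 i.1.2.2).le) hHB hHR hq' hRε'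
            (hH₁R L hL i U₀ hregα) hBR hH₁B (mul_le_mul_of_nonneg_left (hrε L hL) (T3SectALandauChart.eta_pos i.1.1 i.1.2.1 i.1.2.2).le)
            (hA₁R_of_letterReality B₀ C₄ a₃ α r hB₀ hC₄ 𝒢f Wf H₁f norm_G prop4 norm_H₁ hWε h𝒢R hWR hrα hr4 hr16 hH₁R L hL i ε₁ V U₀ hε₁ hV hreg hclose hαe)
            (hXtw''' L hL i ε₁ V U₀ hε₁ hV hreg hclose hαe)))) hMe' A₁ hA₁ hsol

end Summit.QuantumFields.YangMills.Theorems.Prop7StubEXOfChartPiecesTwS3SE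

end
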